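import Literature.AlgebraicGeometry.Frobenioids.KummerPowDuality
import Literature.AlgebraicGeometry.Frobenioids.KummerCupDualTransport
import Literature.AlgebraicGeometry.Frobenioids.PadicKummerGaloisFN
import Literature.AlgebraicGeometry.Frobenioids.PadicKummerLocalField
import Literature.NumberTheory.GaloisRepresentations.LocalWeilDatumExtensionGalois
import Literature.NumberTheory.GaloisRepresentations.LocalFieldFiniteExtension
import HarnessLib

/-!
# Frobenioids II, Def. 2.2 (ii) / Thm. 2.4 (i): local Tate duality for the open subgroup `H ≤ G_K`
# at the Galois binding — `Bijective (Kummer.cupDualH …)` (the input `hH` of row L1-γ₁)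

Mochizuki, *The geometry of Frobenioids II*, Kyushu J. Math. **62** (2008), §2, Def. 2.2 (ii) p. 18:
"by the well-known duality theory of nonarchimedean [mixed-characteristic] local fields [cf., e.g.,
[NSW], Chapter 7, Theorem 7.2.6], the cup product on group cohomology determines an isomorphism
`H¹(H, μ_N(A)) ⥲ H^{ab} ⊗ H²(H, μ_N(A))`" [cite: MochizukiFrdII2008, Def 2.2 (ii) p.18].

Cell abc-iut, row L1-γ₁, milestone M4 (ii) second half (seat abc-iut-w5-d207; plan =
abc-iut-L2-t12's `M4ii-PLAN.md`). For the Definition 2.2 context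
`X = Def22Context.ofGalois L H hH res res_smul` of abc-iut-L1-t7 (`G := G_K` for a
non-archimedean local field `K` of characteristic `0`, `H ⊆ G_K` open normal, `μ_N(A) ≅ μ_N(K̄)`
`G_K`-equivariantly — a `MuModel`), we PROVE

* **`cupDualH_bijective_ofGalois`** — `Function.Bijective (Kummer.cupDualH N O X.HA X.qHA)`
  (stated through the wrapper `Def22Context.cupDualHOf X N`, definitionally the same map): the
  adjoint cup product `H¹(H, μ_N(A)) → Hom(H¹(H, ℤ/N), H²(H, μ_N(A)))` of the profinite group `H`
  is bijective. This is the one residual named input `hH` of abc-iut-L2-t12's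
  `Kummer.cupDual_bijective_of_isCohSaturated` / `Def22Context.dualityIsoOfLocalDuality`, hence of
  the cup-product CONSTRUCTION of the [FrdII] duality isomorphism and of abc-iut-L1-d4's
  naturality hypothesis `hι` of Theorem 2.4 (i).

Route (all inputs in the tree): (T1) `cupDualH_bijective_of_coeffIso` — for ANY context `X`,
along the identity of `X.H`, an isomorphism of `μ_N(A)` (acting through `X.qHA`) with a discrete
`X.H`-module `M` transports the question to the power pairing `M × ℤ/N → M`;
(T2) `powAdjoint_bijective_galFixing` — for `H = Gal(K̄/E₀)`, `E₀ ⊆ K̄` finite over `K`,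
transport along `Γ_{E₀} ≅ Gal(K̄/E₀)` (restriction `absGaloisRestrict` / `liftGal`, continuous
both ways: compact-to-Hausdorff) under which `μ_N(Ē₀)` corresponds to `μ_N(K̄)|_H` via the chosen
`K̄ ≅ Ē₀` (`absClosureEquiv`, `absGaloisRestrict_apply_smul`); (T3) local Tate duality in
adjoint power-pairing form for the local field `E₀` (`powAdjoint_bijective_local`,
`KummerPowDuality.lean`, from the trunk's `localDuality_bijective`). At `ofGalois`,
`E₀ = K̄^H` (`exists_galFixing_eq`) is normal, so `embField K E₀ = E₀` and `μ_N(A) ≅ μ_N(K̄)|_H` is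
abc-iut-L1-d4's `muCoeffIso`. The transports are `ContPairing.cupAdjoint_bijective_iff`.
Classical; nothing here concerns [IUTchIII].
-/

noncomputable section

open CategoryTheory Function

namespace Literature.AlgebraicGeometry.Frobenioids

namespace PadicKummer

namespace Def22Context

open Field IntermediateField
open Literature.NumberTheory.GaloisRepresentations
open Literature.NumberTheory.GaloisRepresentations.LocalWeilDatum
open Literature.NumberTheory.GaloisRepresentations.DiscreteGaloisModule
open _root_.TopRep _root_.ContinuousCohomology

variable {K : Type} [Field K]

/-! ### (T2) ingredients: `μ_N(K̄) ≅ μ_N(Ē₀)` along the chosen `K̄ ≅ Ē₀`, `Γ_{E₀}`-equivariantly -/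

section RootsTransport

variable (E₀ : IntermediateField K (AlgebraicClosure K)) (N : ℕ)

/-- `μ_N(K̄) ⥲ μ_N(Ē₀)` on additive carriers, induced by the chosen `K`-isomorphism `K̄ ≅ Ē₀`
(`absClosureEquiv K E₀`). [cite: SerreGaloisCohomology1997, II §1.2] -/
def muCarrierEquiv : MuCarrier K N ≃+ MuCarrier E₀ N :=
  (MuCarrier.toAdditive (K := K) (n := N)).trans
    ((MulEquiv.toAdditive
      ((absClosureEquiv K E₀).toRingEquiv.toMulEquiv.restrictRootsOfUnity N)).trans
      (MuCarrier.toAdditive (K := E₀) (n := N)).symm)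

/-- On the underlying elements of `K̄`, `muCarrierEquiv` is the chosen embedding `K̄ → Ē₀`.
[cite: SerreGaloisCohomology1997, II §1.2] -/
theorem coe_muCarrierEquiv (y : MuCarrier K N) :
    (((MuCarrier.toAdditive (muCarrierEquiv E₀ N y)).toMul : (AlgebraicClosure E₀)ˣ) :
        AlgebraicClosure E₀) =
      absClosureEmbedding K E₀ (((MuCarrier.toAdditive y).toMul : (AlgebraicClosure K)ˣ) :
        AlgebraicClosure K) := rfl

/-- **`Γ_{E₀}`-equivariance of `μ_N(K̄) ⥲ μ_N(Ē₀)`** along the restriction `Γ_{E₀} → Γ_K`: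
`ι (res σ • ζ) = σ • ι ζ` (`absGaloisRestrict_apply_smul`).
[cite: SerreGaloisCohomology1997, II §1.2] -/
theorem muCarrierEquiv_smul (σ : absoluteGaloisGroup E₀) (y : MuCarrier K N) :
    muCarrierEquiv E₀ N (mu K N (absGaloisRestrict K E₀ σ) y) = mu E₀ N σ (muCarrierEquiv E₀ N y) := by
  apply (MuCarrier.toAdditive (K := E₀) (n := N)).injective
  apply Additive.toMul.injective
  refine Subtype.ext (Units.ext ?_)
  rw [mu_apply_apply (K := E₀), toMul_ofMul, absoluteGaloisGroup.coe_smul_rootsOfUnity,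
    Units.coe_smul, coe_muCarrierEquiv, coe_muCarrierEquiv, mu_apply_apply, toMul_ofMul,
    absoluteGaloisGroup.coe_smul_rootsOfUnity, Units.coe_smul, absGaloisRestrict_apply_smul]

end RootsTransport

/-! ### (T2) ingredients: `Γ_{E₀} ≅ Gal(K̄/E₀)` as topological groups -/

section GroupTransport

variable (E₀ : IntermediateField K (AlgebraicClosure K))

/-- For a NORMAL `E₀ ⊆ K̄`, the copy `embField K E₀ = ι⁻¹(E₀) ⊆ K̄` attached to the chosen
`ι : K̄ ≅ Ē₀` is `E₀` itself (every `K`-embedding of a normal `E₀` into `K̄` has image `E₀`,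
Mathlib `AlgHom.fieldRange_of_normal`). [cite: MilneFT2022, Ch. 7] -/
theorem embField_eq_of_normal [Normal K E₀] : embField K E₀ = E₀ := by
  let f : E₀ →ₐ[K] AlgebraicClosure K := (embField K E₀).val.comp (equivEmbField K E₀).toAlgHom
  have hf : f.fieldRange = E₀ := AlgHom.fieldRange_of_normal f
  suffices h : embField K E₀ = f.fieldRange from h.trans hf
  refine le_antisymm (fun x hx => ?_) (fun x hx => ?_)
  · refine (AlgHom.mem_fieldRange (f := f) (y := x)).2 ⟨(equivEmbField K E₀).symm ⟨x, hx⟩, ?_⟩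
    change (((equivEmbField K E₀) ((equivEmbField K E₀).symm ⟨x, hx⟩) : embField K E₀) :
      AlgebraicClosure K) = x
    rw [AlgEquiv.apply_symm_apply]
  · obtain ⟨y, rfl⟩ := (AlgHom.mem_fieldRange (f := f) (y := x)).1 hx
    exact ((equivEmbField K E₀) y).2

/-- The restriction `Γ_{E₀} → Gal(K̄/ι⁻¹(E₀))`, `σ ↦ σ|_{K̄}` (through the chosen `K̄ ≅ Ē₀`), as a
continuous homomorphism INTO the subgroup. [cite: TateCorvallis1979, (1.4.5)] -/
def resToGalFixing : absoluteGaloisGroup E₀ →ₜ* galFixing K (embField K E₀) where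
  toMonoidHom := (absGaloisRestrict K E₀ : absoluteGaloisGroup E₀ →* absoluteGaloisGroup K).codRestrict
    _ (absGaloisRestrict_mem_galFixing K E₀)
  continuous_toFun := (absGaloisRestrict K E₀).continuous.subtype_mk _

/-- Unfolding `resToGalFixing`: its value in `Γ_K` is the restriction. [cite: TateCorvallis1979, (1.4.5)] -/
@[simp] theorem coe_resToGalFixing (σ : absoluteGaloisGroup E₀) :
    ((resToGalFixing E₀ σ : galFixing K (embField K E₀)) : absoluteGaloisGroup K) =
      absGaloisRestrict K E₀ σ := rfl

/-- The inverse `Gal(K̄/ι⁻¹(E₀)) → Γ_{E₀}`, `γ ↦ ι ∘ γ ∘ ι⁻¹` (`liftGalHom`), is continuous: it is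
the inverse of the continuous bijection `resToGalFixing` from the compact `Γ_{E₀}` onto the
Hausdorff `Gal(K̄/ι⁻¹(E₀))`. [cite: TateCorvallis1979, (1.4.5)] -/
theorem continuous_liftGalHom [CharZero K] : Continuous (liftGalHom K E₀) := by
  haveI : CharZero E₀ := charZero_of_injective_algebraMap (algebraMap K E₀).injective
  let e : absoluteGaloisGroup E₀ ≃ galFixing K (embField K E₀) :=
    { toFun := resToGalFixing E₀
      invFun := liftGalHom K E₀
      left_inv := fun σ =>
        liftGal_absGaloisRestrict K E₀ σ (absGaloisRestrict_mem_galFixing K E₀ σ)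
      right_inv := fun γ => Subtype.ext (absGaloisRestrict_liftGal K E₀ γ.2) }
  have he : Continuous e := (resToGalFixing E₀).continuous
  exact (he.homeoOfEquivCompactToT2 (f := e)).symm.continuous

/-- `Gal(K̄/ι⁻¹(E₀)) → Γ_{E₀}` as a continuous homomorphism. [cite: TateCorvallis1979, (1.4.5)] -/
def liftToAbsGalois [CharZero K] : galFixing K (embField K E₀) →ₜ* absoluteGaloisGroup E₀ :=
  ⟨liftGalHom K E₀, continuous_liftGalHom E₀⟩

/-- Unfolding `liftToAbsGalois`: it is `liftGal`. [cite: TateCorvallis1979, (1.4.5)] -/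
@[simp] theorem liftToAbsGalois_apply [CharZero K] (γ : galFixing K (embField K E₀)) :
    liftToAbsGalois E₀ γ = liftGal K E₀ γ.2 := rfl

end GroupTransport

/-! ### (T2)+(T3): duality for the subgroup `Gal(K̄/E₀) ≤ Γ_K` with coefficients `μ_N(K̄)` -/

section GalFixing

variable [ValuativeRel K] [TopologicalSpace K] [IsNonarchimedeanLocalField K] [CharZero K]
  (E₀ : IntermediateField K (AlgebraicClosure K)) [FiniteDimensional K E₀] (N : ℕ) [NeZero N]
  [LocallyCompactSpace (galFixing K (embField K E₀))]

/-- **Local Tate duality (adjoint power-pairing form) for `Gal(K̄/ι⁻¹(E₀)) ≤ Γ_K` acting on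
`μ_N(K̄)`**, `E₀` finite over the non-archimedean local field `K` of characteristic `0`: the
adjoint `a ↦ (b ↦ a ∪ b)` of `H¹(μ_N(K̄)) × H¹(ℤ/N) → H²(μ_N(K̄))` over the subgroup is bijective —
`powAdjoint_bijective_local` for the local field `E₀`, transported along
`Γ_{E₀} ≅ Gal(K̄/ι⁻¹(E₀))` and `μ_N(Ē₀) ≅ μ_N(K̄)`. (The closed subgroup is compact, hence locally
compact; the instance is taken as a hypothesis to keep this file free of local instance
attributes.) [cite: SerreGaloisCohomology1997, II §5.2 Thm. 2] -/
theorem powAdjoint_bijective_galFixing :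
    Function.Bijective (fun x : continuousCohomology 1
        ((mu K N).restrict (subgroupIncl (galFixing K (embField K E₀)))).toTopRep =>
      ((ContPairing.powPairing N ((mu K N).restrict (subgroupIncl (galFixing K (embField K E₀))))
        (MuCarrier.nsmul_eq_zero' K N)).cupProduct x).toAddMonoidHom) := by
  classical
  haveI : CharZero E₀ := charZero_of_injective_algebraMap (algebraMap K E₀).injective
  set S := galFixing K (embField K E₀) with hS
  set ρK : ContinuousRep S ℤ (MuCarrier K N) := (mu K N).restrict (subgroupIncl S) with hρK
  have hK : ∀ y : MuCarrier K N, N • y = 0 := MuCarrier.nsmul_eq_zero' K N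
  have hE₀ : ∀ y : MuCarrier E₀ N, N • y = 0 := MuCarrier.nsmul_eq_zero' E₀ N
  -- (T3) local Tate duality for the local field `E₀`
  have hT3 : Function.Bijective (fun x : continuousCohomology 1 (mu E₀ N).toTopRep =>
      ((ContPairing.powPairing N (mu E₀ N) hE₀).cupProduct x).toAddMonoidHom) := by
    letI := FiniteExtension.normedField K E₀
    letI := FiniteExtension.valuativeRel K E₀
    haveI : IsNonarchimedeanLocalField E₀ := FiniteExtension.isNonarchimedeanLocalField K E₀
    exact powAdjoint_bijective_local E₀ N
  -- (T2) the coefficient isomorphism, continuous `ℤ`-linear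
  let eμ : MuCarrier K N ≃L[ℤ] MuCarrier E₀ N :=
    { (muCarrierEquiv E₀ N).toIntLinearEquiv with
      continuous_toFun := continuous_of_discreteTopology
      continuous_invFun := continuous_of_discreteTopology }
  have heμ : ∀ y, eμ y = muCarrierEquiv E₀ N y := fun _ => rfl
  let α : TopRep.res ((resToGalFixing E₀ : absoluteGaloisGroup E₀ →ₜ* S) :
      absoluteGaloisGroup E₀ →* S) ρK.toTopRep ⟶ (mu E₀ N).toTopRep :=
    TopRep.ofHom ⟨eμ.toContinuousLinearMap, fun σ => by
      ext y
      change eμ (mu K N (absGaloisRestrict K E₀ σ) y) = mu E₀ N σ (eμ y)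
      rw [heμ, heμ, muCarrierEquiv_smul]⟩
  let α' : TopRep.res ((liftToAbsGalois E₀ : S →ₜ* absoluteGaloisGroup E₀) :
      S →* absoluteGaloisGroup E₀) (mu E₀ N).toTopRep ⟶ ρK.toTopRep :=
    TopRep.ofHom ⟨eμ.symm.toContinuousLinearMap, fun h => by
      ext ξ
      change eμ.symm (mu E₀ N (liftGal K E₀ h.2) ξ) =
        mu K N ((h : S) : absoluteGaloisGroup K) (eμ.symm ξ)
      apply eμ.injective
      rw [eμ.apply_symm_apply, heμ]
      conv_rhs => rw [← absGaloisRestrict_liftGal K E₀ h.2]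
      rw [muCarrierEquiv_smul, ← heμ, eμ.apply_symm_apply]⟩
  let β : TopRep.res ((resToGalFixing E₀ : absoluteGaloisGroup E₀ →ₜ* S) :
      absoluteGaloisGroup E₀ →* S) (ContinuousRep.trivial S ℤ (ZMod N)).toTopRep ⟶
      (ContinuousRep.trivial (absoluteGaloisGroup E₀) ℤ (ZMod N)).toTopRep :=
    TopRep.ofHom ⟨ContinuousLinearMap.id ℤ (ZMod N), fun _ => rfl⟩
  let β' : TopRep.res ((liftToAbsGalois E₀ : S →ₜ* absoluteGaloisGroup E₀) :
      S →* absoluteGaloisGroup E₀)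
      (ContinuousRep.trivial (absoluteGaloisGroup E₀) ℤ (ZMod N)).toTopRep ⟶
      (ContinuousRep.trivial S ℤ (ZMod N)).toTopRep :=
    TopRep.ofHom ⟨ContinuousLinearMap.id ℤ (ZMod N), fun _ => rfl⟩
  refine (ContPairing.cupAdjoint_bijective_iff (ContPairing.powPairing N ρK hK)
    (ContPairing.powPairing N (mu E₀ N) hE₀) (resToGalFixing E₀) (liftToAbsGalois E₀)
    (fun σ => liftGal_absGaloisRestrict K E₀ σ (absGaloisRestrict_mem_galFixing K E₀ σ))
    (fun h => Subtype.ext (absGaloisRestrict_liftGal K E₀ h.2))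
    α α' (fun y => eμ.symm_apply_apply y) (fun ξ => eμ.apply_symm_apply ξ)
    β β' (fun _ => rfl) (fun _ => rfl)
    α α' (fun y => eμ.symm_apply_apply y) (fun ξ => eμ.apply_symm_apply ξ)
    (fun y k => ?_)).2 hT3
  change eμ ((ContPairing.powPairing N ρK hK).toLin y k) =
    (ContPairing.powPairing N (mu E₀ N) hE₀).toLin (eμ y) k
  exact ContPairing.map_powPairing_toLin N ρK hK (mu E₀ N) hE₀
    eμ.toLinearEquiv.toAddEquiv.toAddMonoidHom y k

end GalFixing

/-! ### (T1): any context `X`, along the identity of `X.H` -/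

section AnyContext

variable (X : Def22Context) (N : ℕ) [LocallyCompactSpace X.H]

/-- The adjoint cup product `H¹(H, μ_N(A)) →+ (H¹(H, ℤ/N) →+ H²(H, μ_N(A)))` of a Definition 2.2
context (abc-iut-L2-t12's `Kummer.cupDualH` at `X.O`, `X.HA`, `X.qHA`) — a wrapper fixing the
context's own instances, so that it can be instantiated at the bindings `ofGalois` /
`ofLocalField` without re-synthesising the topology of `Aut_E(A_E)`.
[cite: MochizukiFrdII2008, Def 2.2 (ii) p.18] -/
def cupDualHOf := Kummer.cupDualH N X.O X.HA X.qHA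

/-- `cupDualHOf X N` is `Kummer.cupDualH N X.O X.HA X.qHA`. [cite: MochizukiFrdII2008, Def 2.2 (ii) p.18] -/
theorem cupDualHOf_eq : cupDualHOf X N = Kummer.cupDualH N X.O X.HA X.qHA := rfl

/-- **(T1) Reduction to a coefficient model.** For any Definition 2.2 context `X` and any
isomorphism `e` of topological `X.H`-modules between `μ_N(A)` (acting through `X.qHA`) and a
discrete `X.H`-module `M` killed by `N`, `cupDualH` is bijective as soon as the adjoint of the
power pairing `M × ℤ/N → M` is (naturality of the cup product along `e`; the `ℤ/N`-factor is the
same trivial module on both sides). [cite: MochizukiFrdII2008, Def 2.2 (ii) p.18] -/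
theorem cupDualH_bijective_of_coeffIso {M : Type} [AddCommGroup M] [TopologicalSpace M]
    [DiscreteTopology M] (ρ : ContinuousRep X.H ℤ M) (hM : ∀ y : M, N • y = 0)
    (e : TopRep.res (X.qHA : X.H →* X.HA) (Kummer.muTopRep N X.O X.HA) ≅ ρ.toTopRep)
    (h : Function.Bijective (fun x : continuousCohomology 1 ρ.toTopRep =>
      ((ContPairing.powPairing N ρ hM).cupProduct x).toAddMonoidHom)) :
    Function.Bijective (cupDualHOf X N) := by
  let eT : TopRep.res (X.qHA : X.H →* X.HA) (Kummer.trivTopRep N X.HA) ≅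
      (ContinuousRep.trivial X.H ℤ (ZMod N)).toTopRep :=
    topRepIsoOfEquiv (ContinuousLinearEquiv.refl ℤ (ZMod N)) fun _ _ => rfl
  refine (ContPairing.cupAdjoint_bijective_iff (Kummer.muPowPairingH N X.O X.HA X.qHA)
    (ContPairing.powPairing N ρ hM) (ContinuousMonoidHom.id X.H) (ContinuousMonoidHom.id X.H)
    (fun _ => rfl) (fun _ => rfl)
    (resIdHom e.hom) (resIdHom e.inv) (fun x => ?_) (fun y => ?_)
    (resIdHom eT.hom) (resIdHom eT.inv) (fun _ => rfl) (fun _ => rfl)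
    (resIdHom e.hom) (resIdHom e.inv) (fun x => ?_) (fun y => ?_) (fun x k => ?_)).2 h
  · change (e.hom ≫ e.inv).hom x = x
    rw [e.hom_inv_id]; rfl
  · change (e.inv ≫ e.hom).hom y = y
    rw [e.inv_hom_id]; rfl
  · change (e.hom ≫ e.inv).hom x = x
    rw [e.hom_inv_id]; rfl
  · change (e.inv ≫ e.hom).hom y = y
    rw [e.inv_hom_id]; rfl
  · letI : Module (ZMod N) (Additive (Kummer.Mu N X.O)) := Kummer.Mu.zmodModule N X.O
    letI : Module (ZMod N) M := AddCommGroup.zmodModule hM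
    change e.hom.hom.toContinuousLinearMap (Kummer.muPowBilin N X.O x k) =
      (ContPairing.powPairing N ρ hM).toLin (e.hom.hom.toContinuousLinearMap x) k
    rw [Kummer.muPowBilin_apply, ContPairing.powPairing_toLin]
    let f : Additive (Kummer.Mu N X.O) →+ M := e.hom.hom.toContinuousLinearMap.toLinearMap.toAddMonoidHom
    exact ZMod.map_smul (M := Additive (Kummer.Mu N X.O)) (M₁ := M) f k x

end AnyContext

/-! ### The theorem at the Galois binding -/

section Main

variable (L : IntermediateField K (AlgebraicClosure K)) [Normal K L] [FiniteDimensional K L]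
  (O : Type) [CommMonoid O] [MulDistribMulAction (L ≃ₐ[K] L) O]
  (H : Subgroup (absoluteGaloisGroup K)) [H.Normal] (hH : IsOpen (H : Set (absoluteGaloisGroup K)))
  {AutC : Type} [Group AutC] [IsCancelMul O] [MulDistribMulAction AutC O]
  (res : AutC →* (L ≃ₐ[K] L)) (res_smul : ∀ (α : AutC) (x : O), res α • x = α • x)
  {N : ℕ} (m : MuModel L O N)

/-- `X.H = H` is locally compact at the Galois binding over a field of characteristic `0`
(`H` is open, hence closed, in the profinite `G_K`; FrdII p. 17 "`H ⊆ G` a normal open subgroup").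
[cite: MochizukiFrdII2008, Def 2.2 (i) p.17] -/
theorem locallyCompactSpace_H_ofGalois [CharZero K] :
    LocallyCompactSpace (ofGalois L H hH res res_smul).H := by
  have hc : IsClosed (H : Set (absoluteGaloisGroup K)) := OpenSubgroup.isClosed ⟨H, hH⟩
  haveI : CompactSpace H := isCompact_iff_compactSpace.mp hc.isCompact
  exact inferInstanceAs (LocallyCompactSpace H)

include m in
/-- **Local Tate duality for the open `H ≤ G_K`, at the Galois binding** (FrdII Def. 2.2 (ii)
p. 18, the input "by the well-known duality theory of nonarchimedean local fields … the cup
product on group cohomology determines an isomorphism `H¹(H, μ_N(A)) ⥲ H^ab ⊗ H²(H, μ_N(A))`"):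
for `K` a non-archimedean local field of characteristic `0`, `H ⊆ G_K` open normal, `N ≥ 1` and a
`G_K`-equivariant identification `μ_N(A) ≅ μ_N(K̄)` (`m : MuModel L O N`), the adjoint cup product
`Kummer.cupDualH : H¹(H, μ_N(A)) → Hom(H¹(H, ℤ/N), H²(H, μ_N(A)))` of the context
`X = Def22Context.ofGalois L H hH res res_smul` (through `cupDualHOf X N`) is BIJECTIVE — the
residual input `hH` of `Kummer.cupDual_bijective_of_isCohSaturated` (abc-iut-L2-t12).
[cite: MochizukiFrdII2008, Def 2.2 (ii) p.18] -/
theorem cupDualH_bijective_ofGalois [ValuativeRel K] [TopologicalSpace K] [IsNonarchimedeanLocalField K]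
    [CharZero K] [NeZero N] [LocallyCompactSpace (ofGalois L H hH res res_smul).H] :
    Function.Bijective (cupDualHOf (ofGalois L H hH res res_smul) N) := by
  -- `H = Gal(K̄/E₀)` with `E₀` finite Galois, and `embField K E₀ = E₀`
  obtain ⟨E₀, hfin, hgal, hE⟩ := exists_galFixing_eq H hH
  haveI := hfin
  haveI := hgal
  have hH' : galFixing K (embField K E₀) = H := by rw [embField_eq_of_normal E₀]; exact hE
  subst hH'
  haveI : LocallyCompactSpace (galFixing K (embField K E₀)) :=
    ‹LocallyCompactSpace (ofGalois L (galFixing K (embField K E₀)) hH res res_smul).H›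
  exact cupDualH_bijective_of_coeffIso (ofGalois L (galFixing K (embField K E₀)) hH res res_smul) N
    ((mu K N).restrict (subgroupIncl (galFixing K (embField K E₀)))) (MuCarrier.nsmul_eq_zero' K N)
    (muCoeffIso L O (galFixing K (embField K E₀)) hH res res_smul m)
    (powAdjoint_bijective_galFixing E₀ N)

end Main

/-! ### At `Def22Context.ofLocalField` (abc-iut-L2-t12's `M4ii-PLAN.md` target) -/

section LocalFieldBinding

variable (L : IntermediateField K (AlgebraicClosure K)) [Normal K L] [FiniteDimensional K L]
  (H : Subgroup (absoluteGaloisGroup K)) [H.Normal] (hH : IsOpen (H : Set (absoluteGaloisGroup K)))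
  (S : StableSubmonoid L) (N : ℕ) [NeZero N]

/-- **`hH` at `Def22Context.ofLocalField`** (abc-iut-L2-t12's `M4ii-PLAN.md` target): for `K` a
non-archimedean local field of characteristic `0`, `H ⊆ G_K` open normal, `O^□(A) = O^□_L` a
`Gal(L/K)`-stable submonoid `S` of `L` containing the `N`-th roots of unity of `L`, and
`μ_N(K̄) ⊆ L` (`A` is `μ_N`-saturated), the adjoint cup product
`Kummer.cupDualH : H¹(H, μ_N(A)) → Hom(H¹(H, ℤ/N), H²(H, μ_N(A)))` of `ofLocalField L H hH S`
(through `cupDualHOf`) is bijective. [cite: MochizukiFrdII2008, Def 2.2 (ii) p.18] -/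
theorem cupDualH_bijective_ofLocalField [ValuativeRel K] [TopologicalSpace K]
    [IsNonarchimedeanLocalField K] [CharZero K]
    (hS : ∀ x : L, x ^ N = 1 → x ∈ S.toSubmonoid)
    (hμ : ∀ ζ : rootsOfUnity N (AlgebraicClosure K),
      ((ζ : (AlgebraicClosure K)ˣ) : AlgebraicClosure K) ∈ L)
    [LocallyCompactSpace (ofLocalField L H hH S).H] :
    Function.Bijective (cupDualHOf (ofLocalField L H hH S) N) :=
  cupDualH_bijective_ofGalois L (GalMonoid S) H hH (MonoidHom.id _) (fun _ _ => rfl)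
    (muModelOfSubmonoid L S N hS (NeZero.pos N) hμ)

end LocalFieldBinding

end Def22Context

end PadicKummer

end Literature.AlgebraicGeometry.Frobenioids

end
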